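import Summits.NavierStokesRegularity.NavierStokesRegularity.Theorems.SheetLaws
import Summits.NavierStokesRegularity.NavierStokesRegularity.Theorems.SwirlHolderTowerFunnelDrift
import HarnessLib

/-!
# ROUND-21 (nsreg-p2, gen 23) — THE SHEET LAWS, Part 3/4: KERNEL CERTIFICATES [A1] (the odd-contrast
# equation from the tree's `swirl_transport_holds`) and [A2] (the funnel never compresses)

Landed for the planner seat nsreg-p2 (gen 23) by the prover seat nsreg-p4 (gen 14) as route-line
material of `SwirlThreshold` (`--supports stmt-NavierStokesRegularity-2002`): the text of the declarations is
VERBATIM the planner's companion `HOME/ns-regularity-ideate-p2/R21-SheetLaws.lean` (v8, sha16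
e3c548b310767775), split into files of ≤ 400 lines (this file: §§6–7 — `oddContrast_transport` with the inverse-height calculus, `sheetCompression_funnelDrift(_nonpos)`).

WHAT THIS IS NOT: identities for classical solutions / the explicit funnel drift; no regularity claim.
-/

namespace Summit.NavierStokesRegularity.NavierStokesRegularity.Theorems.SheetLaws

open MeasureTheory Set Filter Topology Metric WithLp
open scoped ENNReal NNReal
open Literature.Analysis Literature.Analysis.FluidPDE

/-! ## 6. KERNEL CERTIFICATE of identity [A1]: the odd-contrast equation, derived from the tree's
swirl transport equation `Fluid.swirl_transport_holds` (KNSS 2009 (1.8))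

This section upgrades [A1] from a sympy identity (kit j285699) to a theorem over the tree's
Navier–Stokes definitions: for every classical solution with axisymmetric velocity and pressure and
zero forcing, pointwise off the axis (`r ≠ 0`) and off the sheet (`z ≠ 0`),
`∂ₜχ + (u·∇)χ = (-u_z/z)·χ + ν (Δχ − (2/r)∂ᵣχ + (2/z)∂_zχ)`, `χ = Γ/z`.
No parity assumption is needed for the identity itself; the odd class enters only through the
boundary behaviour on the sheet (there `χ → ∂_zΓ`, finite) used by the maximum principle S-21.1. -/

section KernelCertificateA1

open scoped Laplacian InnerProductSpace RealInnerProductSpace ContDiff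
open Literature.Analysis.PDE.LoewnerNirenberg

/-! ### Calculus of the inverse height `y ↦ 1/y₂` off the sheet -/

/-- `χ = (1/z) · Γ` as a scalar multiple (the Lean `oddContrast` unfolds to `Γ / z`). -/
theorem oddContrast_eq_smul (v : EuclideanSpace ℝ (Fin 3) → EuclideanSpace ℝ (Fin 3)) :
    oddContrast v = fun y => (y 2)⁻¹ • swirl v y := by
  funext y
  simp only [oddContrast, smul_eq_mul, div_eq_inv_mul]

/-- Derivative of the inverse height: `D(1/z)(x) = -(1/z²) dz` off the sheet. -/
theorem hasFDerivAt_invHeight {x : EuclideanSpace ℝ (Fin 3)} (hz : x 2 ≠ 0) :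
    HasFDerivAt (fun y : EuclideanSpace ℝ (Fin 3) => (y 2)⁻¹)
      ((-((x 2) ^ 2)⁻¹) • (EuclideanSpace.proj (2 : Fin 3) : EuclideanSpace ℝ (Fin 3) →L[ℝ] ℝ))
      x := by
  have h1 : HasFDerivAt (fun y : EuclideanSpace ℝ (Fin 3) => y 2)
      (EuclideanSpace.proj (2 : Fin 3) : EuclideanSpace ℝ (Fin 3) →L[ℝ] ℝ) x :=
    (EuclideanSpace.proj (2 : Fin 3) : EuclideanSpace ℝ (Fin 3) →L[ℝ] ℝ).hasFDerivAt
  exact (hasDerivAt_inv hz).comp_hasFDerivAt x h1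

/-- `D(1/z)(x) e = -e₂/z²` off the sheet. -/
theorem fderiv_invHeight {x : EuclideanSpace ℝ (Fin 3)} (hz : x 2 ≠ 0)
    (e : EuclideanSpace ℝ (Fin 3)) :
    fderiv ℝ (fun y : EuclideanSpace ℝ (Fin 3) => (y 2)⁻¹) x e = -((x 2) ^ 2)⁻¹ * e 2 := by
  rw [(hasFDerivAt_invHeight hz).fderiv]
  rfl

/-- The inverse height `1/z` is smooth off the sheet. -/
theorem contDiffAt_invHeight {x : EuclideanSpace ℝ (Fin 3)} (hz : x 2 ≠ 0) {n : WithTop ℕ∞} :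
    ContDiffAt ℝ n (fun y : EuclideanSpace ℝ (Fin 3) => (y 2)⁻¹) x :=
  (contDiffAt_inv ℝ hz).comp x
    (EuclideanSpace.proj (2 : Fin 3) : EuclideanSpace ℝ (Fin 3) →L[ℝ] ℝ).contDiff.contDiffAt

/-- `Δ(1/z) = 2/z³` off the sheet. -/
theorem laplacian_invHeight {x : EuclideanSpace ℝ (Fin 3)} (hz : x 2 ≠ 0) :
    (Δ (fun y : EuclideanSpace ℝ (Fin 3) => (y 2)⁻¹)) x = 2 * ((x 2) ^ 3)⁻¹ := by
  have hfun : (fun y : EuclideanSpace ℝ (Fin 3) => (y 2)⁻¹) =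
      fun w : EuclideanSpace ℝ (Fin 3) =>
        (fun σ : ℝ => σ⁻¹) ⟪EuclideanSpace.single (2 : Fin 3) (1 : ℝ), w⟫_ℝ := by
    funext w
    simp [EuclideanSpace.inner_single_left]
  have hx2 : ⟪EuclideanSpace.single (2 : Fin 3) (1 : ℝ), x⟫_ℝ = x 2 := by
    simp [EuclideanSpace.inner_single_left]
  have hg : ∀ σ ∈ ({σ : ℝ | σ ≠ 0}), HasDerivAt (fun y : ℝ => y⁻¹)
      ((fun σ : ℝ => -(σ ^ 2)⁻¹) σ) σ := fun σ hσ => hasDerivAt_inv hσ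
  have hg₁ : HasDerivAt (fun σ : ℝ => -(σ ^ 2)⁻¹) (2 * ((x 2) ^ 3)⁻¹) (x 2) := by
    have h1 : HasDerivAt (fun σ : ℝ => σ ^ 2) (2 * x 2) (x 2) := by
      simpa using hasDerivAt_pow 2 (x 2)
    refine ((h1.inv (pow_ne_zero 2 hz)).neg).congr_deriv ?_
    have hz4 : ((x 2) ^ 2) ^ 2 ≠ 0 := pow_ne_zero 2 (pow_ne_zero 2 hz)
    rw [neg_div, neg_neg, div_eq_iff hz4]
    field_simp
  have hzU : ⟪EuclideanSpace.single (2 : Fin 3) (1 : ℝ), x⟫_ℝ ∈ ({σ : ℝ | σ ≠ 0}) := by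
    rw [hx2]; exact hz
  rw [hfun, laplacian_comp_inner isOpen_ne hg _ hzU (by rw [hx2]; exact hg₁)]
  simp

/-! ### The odd-contrast equation -/

/-- **[A1] The odd-contrast equation (kernel certificate).**  For a classical Navier–Stokes
solution on `ℝ³ × S` with axisymmetric velocity and pressure and zero forcing, the odd contrast
`χ = Γ/z` satisfies, off the axis and off the sheet,
`∂ₜχ + (u·∇)χ = (-u_z/z)·χ + ν (Δχ − (2/r)∂ᵣχ + (2/z)∂_zχ)`:
a drift–diffusion equation whose ONLY zeroth-order term is the sheet-compression potential
`-u_z/z` — no source.  Derived from the tree's swirl transport equation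
`Fluid.swirl_transport_holds` (KNSS 2009 (1.8)) by the Leibniz rules for `χ = (1/z)·Γ`. -/
theorem oddContrast_transport {S : Set ℝ} {ν : ℝ}
    {u : ℝ → EuclideanSpace ℝ (Fin 3) → EuclideanSpace ℝ (Fin 3)}
    {p : ℝ → EuclideanSpace ℝ (Fin 3) → ℝ}
    (h : IsClassicalNSSolutionOn S ν 0 u p) (hu : ∀ t ∈ S, IsAxisymmetric (u t))
    (hp : ∀ t ∈ S, IsAxisymmetricScalar (p t)) {t : ℝ} (ht : t ∈ S)
    {x : EuclideanSpace ℝ (Fin 3)} (hx : cylRadius x ≠ 0) (hz : x 2 ≠ 0) :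
    timeDerivWithin S (fun s => oddContrast (u s)) t x + convect (u t) (oddContrast (u t)) x =
      sheetCompression (u t) x * oddContrast (u t) x +
        ν * ((Δ (oddContrast (u t))) x
              - 2 / cylRadius x * partialDeriv (eR x) (oddContrast (u t)) x
              + 2 / x 2 * partialDeriv (EuclideanSpace.single (2 : Fin 3) (1 : ℝ))
                  (oddContrast (u t)) x) := by
  -- the swirl equation at `(t, x)` with zero forcing
  have hΓ := swirl_transport_holds h hu hp ht hx
  have hf0 : swirl ((0 : ℝ → EuclideanSpace ℝ (Fin 3) → EuclideanSpace ℝ (Fin 3)) t) x = 0 := by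
    simp [swirl]
  rw [hf0, add_zero] at hΓ
  -- regularity
  have hU2 : ContDiff ℝ 2 (u t) := (h.contDiff_velocity ht).of_le (by norm_cast)
  have hΓ2 : ContDiff ℝ 2 (swirl (u t)) := contDiff_swirl hU2
  have hΓd : DifferentiableAt ℝ (swirl (u t)) x := (hΓ2.differentiable two_ne_zero) x
  have hf2 : ContDiffAt ℝ 2 (fun y : EuclideanSpace ℝ (Fin 3) => (y 2)⁻¹) x :=
    contDiffAt_invHeight hz
  have hfd := hasFDerivAt_invHeight hz
  -- (1) time derivative: `∂ₜχ = (1/z) ∂ₜΓ`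
  have h1 : timeDerivWithin S (fun s => oddContrast (u s)) t x =
      (x 2)⁻¹ * timeDerivWithin S (fun s => swirl (u s)) t x := by
    simp only [timeDerivWithin_apply]
    have hd : DifferentiableWithinAt ℝ (fun s => swirl (u s) x) S t := by
      simp only [swirl_eq_inner_rotGen]
      exact (differentiableWithinAt_const (rotGen x)).inner ℝ
        (h.smooth_velocity.differentiableWithinAt_time ht x)
    have := derivWithin_clm_comp_apply ((x 2)⁻¹ • ContinuousLinearMap.id ℝ ℝ) hd
    simpa [oddContrast, div_eq_inv_mul] using this
  -- (2) spatial first derivatives: `Dχ(x) e = (1/z) DΓ(x) e − (e₂/z²) Γ(x)`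
  have h2 : ∀ e : EuclideanSpace ℝ (Fin 3), fderiv ℝ (oddContrast (u t)) x e =
      (x 2)⁻¹ * fderiv ℝ (swirl (u t)) x e + (-((x 2) ^ 2)⁻¹ * e 2) * swirl (u t) x := by
    intro e
    rw [oddContrast_eq_smul, fderiv_fun_smul hfd.differentiableAt hΓd]
    simp only [_root_.add_apply, _root_.smul_apply,
      ContinuousLinearMap.smulRight_apply, smul_eq_mul, fderiv_invHeight hz]
  -- (3) Laplacian: Leibniz rule
  have h3 : (Δ (oddContrast (u t))) x =
      2 * ((x 2) ^ 3)⁻¹ * swirl (u t) x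
        + 2 * (-((x 2) ^ 2)⁻¹ * fderiv ℝ (swirl (u t)) x (EuclideanSpace.single (2 : Fin 3) (1 : ℝ)))
        + (x 2)⁻¹ * (Δ (swirl (u t))) x := by
    rw [oddContrast_eq_smul, laplacian_smul_apply hf2 hΓ2.contDiffAt (EuclideanSpace.basisFun (Fin 3) ℝ),
      laplacian_invHeight hz]
    simp only [Fin.sum_univ_three, EuclideanSpace.basisFun_apply, fderiv_invHeight hz,
      PiLp.single_apply, smul_eq_mul, Fin.isValue, Fin.reduceEq, if_true, if_false]
    ring
  -- assemble
  simp only [convect_apply, partialDeriv_apply] at hΓ ⊢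
  rw [h1, h2, h2, h2, h3, SwirlHolderTower.eR_apply_two, sheetCompression, oddContrast]
  simp only [PiLp.single_apply, Fin.isValue, if_true]
  have hD : timeDerivWithin S (fun s => swirl (u s)) t x =
      ν * ((Δ (swirl (u t))) x - 2 / cylRadius x * fderiv ℝ (swirl (u t)) x (eR x))
        - fderiv ℝ (swirl (u t)) x (u t x) := by
    linarith [hΓ]
  rw [hD]
  field_simp
  ring


end KernelCertificateA1

/-! ## 7. KERNEL CERTIFICATE of [A2]: the funnel never compresses

For the tree's funnel drift `u_N = SwirlHolderTower.funnelDrift N` the sheet-compression rate is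
`-u_z/z = -N z²/|x|⁴ ≤ 0` (`N ≥ 0`): the only resource that can create odd contrast (S-21.1) is
identically absent in a funnel, at every scale. -/

section KernelCertificateA2

open Summit.NavierStokesRegularity.NavierStokesRegularity.Theorems.SwirlHolderTower

/-- **[A2] The funnel never compresses (kernel certificate).**  For the tree's funnel drift
`u_N = funnelDrift N` (`SwirlHolderTowerFunnel`): `-u_z/z = -N z²/|x|⁴` off the sheet. -/
theorem sheetCompression_funnelDrift (N : ℝ) {x : EuclideanSpace ℝ (Fin 3)} (hz : x 2 ≠ 0) :
    sheetCompression (funnelDrift N) x = -(N * (x 2) ^ 2 / ‖x‖ ^ 4) := by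
  unfold sheetCompression funnelDrift
  simp only [PiLp.smul_apply, smul_eq_mul, Matrix.cons_val_two, Matrix.tail_cons,
    Matrix.head_cons]
  by_cases hx : ‖x‖ = 0
  · simp [hx]
  · field_simp

/-- **[A2]′** `-u_z/z ≤ 0` everywhere for the funnel with `N ≥ 0` (junk points included):
no compression budget is ever available to a funnel — the unsteady resource of ROUND-21 is absent. -/
theorem sheetCompression_funnelDrift_nonpos {N : ℝ} (hN : 0 ≤ N) (x : EuclideanSpace ℝ (Fin 3)) :
    sheetCompression (funnelDrift N) x ≤ 0 := by
  by_cases hz : x 2 = 0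
  · simp [sheetCompression, hz]
  · rw [sheetCompression_funnelDrift N hz, neg_nonpos]
    positivity


end KernelCertificateA2

end Summit.NavierStokesRegularity.NavierStokesRegularity.Theorems.SheetLaws
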